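import Literature.InformationTheory.QuantumCodes.IrreducibleCountingThreshold
import Mathlib.Algebra.Module.Equiv.Basic
import Mathlib.Algebra.Module.Submodule.Map
import HarnessLib

/-!
# The Dumer–Kovalev–Pryadko row-weight threshold bound — arbitrary finite index types, any decoder map

Topic `Literature/InformationTheory/QuantumCodes` (venture QEC, LADDER-QEC rung Q5). The certified
code-capacity bound `sum_decodingFails_bernoulli_le_of_rowWeight` of `IrreducibleCountingThreshold.lean`
(qec-lit-2; Dumer–Kovalev–Pryadko 2015 Thm. 2 at `y = 0`: one error type of a CSS/LDPC code with check
weight `≤ w` under ANY minimum-weight decoder and independent errors, `Σ_{E fails} p^{|E|}(1-p)^{n-|E|} ≤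
n r^d/((w-1)(1-r))`, `r = 2(w-1)√(p(1-p))`) is stated there for `Fin`-indexed matrices, error SETS
`E ⊆ Fin n` and decoders `(Fin m → ZMod 2) → (Fin n → ZMod 2)`. This theorem-only file TRANSPORTS it,
along `Fintype.equivFin`, to an arbitrary finite check index `C` and qubit index `V`, a decoder
`D : (C → ZMod 2) → (V → ZMod 2)` given by the two defining properties of a minimum-weight decoder, and
error VECTORS `e : V → ZMod 2` weighted by `bernoulliWeight p (supp e)` — the shape in which the toric
space-time decoding problem (`ToricCodePhenomenological.lean`) is typed. Nothing is re-proved or restated.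

## References

* [DumerKovalevPryadko2015] I. Dumer, A. A. Kovalev, L. P. Pryadko, PRL 115 (2015) 050502, Thm. 2 (`y = 0`).
-/

namespace Literature.InformationTheory.QuantumCodes

open Finset Matrix

/-- A binary vector is the indicator vector of its support. [folklore] -/
private theorem errorVec_supp {n : ℕ} (x : Fin n → ZMod 2) : errorVec (supp x) = x := by
  funext i
  simp only [errorVec, supp, Finset.mem_filter, Finset.mem_univ, true_and]
  have key : ∀ a : ZMod 2, (if a ≠ 0 then (1 : ZMod 2) else 0) = a := by decide
  exact key (x i)

/-- Relabelling the coordinates does not change the Hamming weight. [folklore] -/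
private theorem hammingNorm_comp_finEquiv' {V : Type*} [Fintype V] {n : ℕ} (x : V → ZMod 2)
    (e : Fin n ≃ V) : hammingNorm (x ∘ e) = hammingNorm x := by
  unfold hammingNorm
  refine Finset.card_equiv e (fun i => ?_)
  simp

/-- Binary vectors are determined by their supports. [folklore] -/
private theorem supp_injective' {V : Type*} [Fintype V] [DecidableEq V] :
    Function.Injective (supp : (V → ZMod 2) → Finset V) := by
  intro e₁ e₂ h
  funext v
  have h1 : v ∈ supp e₁ ↔ v ∈ supp e₂ := by rw [h]
  simp only [supp, Finset.mem_filter, Finset.mem_univ, true_and] at h1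
  have key : ∀ a b : ZMod 2, (a ≠ 0 ↔ b ≠ 0) → a = b := by decide
  exact key _ _ h1

/-- **Dumer–Kovalev–Pryadko's row-weight bound for arbitrary finite index types and error vectors.**
Let `H : Matrix C V (ZMod 2)` have row supports of size `≤ w` (`w ≥ 2`), let `SX` be the trivial-error
subspace with every zero-syndrome vector outside it of weight `≥ d ≥ 1`, and let `D` be a minimum-weight
decoder (`H D(H e) = H e` and `‖D(H e)‖ ≤ ‖x‖` whenever `H x = H e`). Then for independent errors of
rate `0 ≤ p ≤ 1/2` with `r := 2(w-1)√(p(1-p)) < 1`, the total Bernoulli weight of the error vectors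
`e` with `e + D(H e) ∉ SX` is at most `|V| · r^d / ((w-1)(1-r))`. Proved by transport to `Fin`-indices.
[cite: DumerKovalevPryadko2015, Thm 2 (y = 0: (w-1)·2√(p(1-p)) < 1)] -/
theorem sum_decodingFails_bernoulli_le_of_rowWeight' {C V : Type*} [Fintype C] [Fintype V]
    [DecidableEq V] (H : Matrix C V (ZMod 2)) (SX : Submodule (ZMod 2) (V → ZMod 2))
    {D : (C → ZMod 2) → (V → ZMod 2)} (hDsyn : ∀ e : V → ZMod 2, H *ᵥ D (H *ᵥ e) = H *ᵥ e)
    (hDmin : ∀ e x : V → ZMod 2, H *ᵥ x = H *ᵥ e → hammingNorm (D (H *ᵥ e)) ≤ hammingNorm x)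
    {w : ℕ} (hw : 2 ≤ w) (hrow : ∀ c : C, (univ.filter fun v => H c v ≠ 0).card ≤ w) {d : ℕ}
    (hd1 : 1 ≤ d) (hd : ∀ x : V → ZMod 2, H *ᵥ x = 0 → x ∉ SX → d ≤ hammingNorm x)
    {p : ℝ} (hp0 : 0 ≤ p) (hp : p ≤ 1 / 2)
    (hr : 2 * ((w - 1 : ℕ) : ℝ) * Real.sqrt (p * (1 - p)) < 1)
    [DecidablePred fun e : V → ZMod 2 => e + D (H *ᵥ e) ∉ SX] :
    ∑ e ∈ univ.filter (fun e : V → ZMod 2 => e + D (H *ᵥ e) ∉ SX), bernoulliWeight p (supp e) ≤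
      (Fintype.card V : ℝ) * (2 * ((w - 1 : ℕ) : ℝ) * Real.sqrt (p * (1 - p))) ^ d /
        (((w - 1 : ℕ) : ℝ) * (1 - 2 * ((w - 1 : ℕ) : ℝ) * Real.sqrt (p * (1 - p)))) := by
  classical
  -- relabel qubits and checks by `Fin`
  set eV : Fin (Fintype.card V) ≃ V := (Fintype.equivFin V).symm with heV
  set eC : Fin (Fintype.card C) ≃ C := (Fintype.equivFin C).symm with heC
  set H' : Matrix (Fin (Fintype.card C)) (Fin (Fintype.card V)) (ZMod 2) := H.submatrix eC eV
    with hH'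
  set φ : (V → ZMod 2) ≃ₗ[ZMod 2] (Fin (Fintype.card V) → ZMod 2) :=
    LinearEquiv.funCongrLeft (ZMod 2) (ZMod 2) eV with hφ
  have hφapp : ∀ x : V → ZMod 2, φ x = x ∘ eV := fun x => rfl
  set SX' : Submodule (ZMod 2) (Fin (Fintype.card V) → ZMod 2) := Submodule.map φ.toLinearMap SX
    with hSX'
  have hmemSX' : ∀ x : V → ZMod 2, x ∘ eV ∈ SX' ↔ x ∈ SX := by
    intro x
    rw [← hφapp, hSX']
    constructor
    · intro h
      obtain ⟨y, hy, hyx⟩ := Submodule.mem_map.1 h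
      have : y = x := φ.injective (by simpa using hyx)
      rwa [this] at hy
    · intro h
      exact Submodule.mem_map.2 ⟨x, h, rfl⟩
  have hsurj : ∀ x' : Fin (Fintype.card V) → ZMod 2, ∃ x : V → ZMod 2, x' = x ∘ eV := fun x' =>
    ⟨x' ∘ eV.symm, by funext i; simp⟩
  have hmul : ∀ x : V → ZMod 2, H' *ᵥ (x ∘ eV) = (H *ᵥ x) ∘ eC := by
    intro x
    rw [hH', Matrix.submatrix_mulVec_equiv]
    congr 2
    funext v
    simp
  have hcancel : ∀ y z : C → ZMod 2, y ∘ eC = z ∘ eC → y = z := by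
    intro y z h
    funext c
    have := congrFun h (eC.symm c)
    simpa using this
  have huncomp : ∀ y : C → ZMod 2, (y ∘ eC) ∘ eC.symm = y := by
    intro y; funext c; simp
  -- the transported decoder
  set D' : (Fin (Fintype.card C) → ZMod 2) → (Fin (Fintype.card V) → ZMod 2) :=
    fun σ' => D (σ' ∘ eC.symm) ∘ eV with hD'
  have hD'app : ∀ e : V → ZMod 2, D' (H' *ᵥ (e ∘ eV)) = D (H *ᵥ e) ∘ eV := by
    intro e
    rw [hmul]
    show D (((H *ᵥ e) ∘ eC) ∘ eC.symm) ∘ eV = _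
    rw [huncomp]
  have hD'min : IsMinWeightDecoder H' D' := by
    intro e'
    obtain ⟨e, rfl⟩ := hsurj e'
    refine ⟨?_, fun x' hx' => ?_⟩
    · rw [hD'app, hmul, hmul, hDsyn]
    · obtain ⟨x, rfl⟩ := hsurj x'
      rw [hD'app, hammingNorm_comp_finEquiv', hammingNorm_comp_finEquiv']
      rw [hmul, hmul] at hx'
      exact hDmin e x (hcancel _ _ hx')
  -- transported row weights and distance
  have hrow' : ∀ i, (rowSupp H' i).card ≤ w := by
    intro i
    have hcard : (rowSupp H' i).card = (univ.filter fun v => H (eC i) v ≠ 0).card := by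
      refine Finset.card_equiv eV (fun j => ?_)
      simp [rowSupp, hH']
    rw [hcard]
    exact hrow (eC i)
  have hd' : ∀ x' : Fin (Fintype.card V) → ZMod 2, H' *ᵥ x' = 0 → x' ∉ SX' → d ≤ hammingNorm x' := by
    intro x' hx' hxS
    obtain ⟨x, rfl⟩ := hsurj x'
    rw [hammingNorm_comp_finEquiv']
    refine hd x ?_ (fun h => hxS ((hmemSX' x).2 h))
    rw [hmul] at hx'
    exact hcancel _ _ (by rw [hx']; rfl)
  -- the failing error vectors map injectively into the failing error sets of the `Fin` problem
  set ψ : (V → ZMod 2) → Finset (Fin (Fintype.card V)) := fun e => supp (e ∘ eV) with hψ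
  have hψinj : Function.Injective ψ := by
    intro e₁ e₂ h
    have h' : e₁ ∘ eV = e₂ ∘ eV := supp_injective' h
    funext v
    have := congrFun h' (eV.symm v)
    simpa using this
  have hψw : ∀ e : V → ZMod 2, bernoulliWeight p (ψ e) = bernoulliWeight p (supp e) := by
    intro e
    simp only [bernoulliWeight, hψ, Fintype.card_fin]
    have hc : (supp (e ∘ eV)).card = (supp e).card := hammingNorm_comp_finEquiv' e eV
    rw [hc]
  have hψfail : ∀ e : V → ZMod 2, e + D (H *ᵥ e) ∉ SX → DecodingFails H' SX' D' (ψ e) := by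
    intro e he
    show errorVec (supp (e ∘ eV)) + D' (H' *ᵥ errorVec (supp (e ∘ eV))) ∉ SX'
    rw [errorVec_supp, hD'app]
    have : e ∘ eV + D (H *ᵥ e) ∘ eV = (e + D (H *ᵥ e)) ∘ eV := rfl
    rw [this, hmemSX']
    exact he
  set F := univ.filter (fun e : V → ZMod 2 => e + D (H *ᵥ e) ∉ SX) with hF
  have h1 : ∑ e ∈ F, bernoulliWeight p (supp e) = ∑ E' ∈ F.image ψ, bernoulliWeight p E' := by
    rw [Finset.sum_image fun e₁ _ e₂ _ h => hψinj h]
    exact Finset.sum_congr rfl fun e _ => (hψw e).symm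
  have hsub : F.image ψ ⊆ univ.filter fun E' => DecodingFails H' SX' D' E' := by
    intro E' hE'
    obtain ⟨e, he, rfl⟩ := Finset.mem_image.1 hE'
    rw [hF, Finset.mem_filter] at he
    exact Finset.mem_filter.2 ⟨Finset.mem_univ _, hψfail e he.2⟩
  have hp1 : p ≤ 1 := hp.trans (by norm_num)
  rw [h1]
  refine (Finset.sum_le_sum_of_subset_of_nonneg hsub fun E' _ _ =>
    bernoulliWeight_nonneg hp0 hp1 E').trans ?_
  have h2 := sum_decodingFails_bernoulli_le_of_rowWeight H' SX' hD'min hw hrow' hd1 hd' hp0 hp hr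
  convert h2 using 2

end Literature.InformationTheory.QuantumCodes
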